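import Mathlib

/-!
# The sign character of an index-2 subgroup

The kernel object behind «η_v = the norm character» (route/T5-route-2.md §N5.12, (A8a)/(A11)): a
subgroup `H` of index 2 in a group `G` has a unique character `G →* ℤˣ` with kernel `H`
(`signChar`, `signChar_eq_one_iff`, `eq_signChar`); it is quadratic and non-trivial.  With the norm
index theorems of `T5AdicCompletionNormGroup` (inert) and `T5TameRamifiedNormGroup` (tamely
ramified) this makes the local quadratic character `η_v := signChar (normGroup σ)` a concrete
kernel object at every non-split finite place of odd residue characteristic.

Declaration per README §8(d): «uses an L-value-free non-vanishing device: NO».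
-/

namespace Summit.Ventures.HodgeRepro2.T5IndexTwoCharacter

variable {G : Type*} [Group G] (H : Subgroup G)

/-- The sign character of an index-2 subgroup: `1` on `H`, `−1` off `H`. -/
noncomputable def signChar (hH : H.index = 2) : G →* ℤˣ where
  toFun g := by classical exact if g ∈ H then 1 else -1
  map_one' := if_pos H.one_mem
  map_mul' := by
    intro a b
    classical
    by_cases ha : a ∈ H <;> by_cases hb : b ∈ H
    · rw [if_pos ha, if_pos hb, if_pos (H.mul_mem ha hb), one_mul]
    · rw [if_pos ha, if_neg hb, if_neg, one_mul]
      rw [Subgroup.mul_mem_iff_of_index_two hH]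
      exact fun h => hb (h.mp ha)
    · rw [if_neg ha, if_pos hb, if_neg, mul_one]
      rw [Subgroup.mul_mem_iff_of_index_two hH]
      exact fun h => ha (h.mpr hb)
    · rw [if_neg ha, if_neg hb, if_pos]
      · norm_num
      · rw [Subgroup.mul_mem_iff_of_index_two hH]
        exact ⟨fun h => absurd h ha, fun h => absurd h hb⟩

/-- `signChar g = 1` on `H`. -/
theorem signChar_apply_of_mem (hH : H.index = 2) {g : G} (hg : g ∈ H) : signChar H hH g = 1 := by
  classical
  change (if g ∈ H then (1 : ℤˣ) else -1) = 1
  rw [if_pos hg]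

/-- `signChar g = −1` off `H`. -/
theorem signChar_apply_of_notMem (hH : H.index = 2) {g : G} (hg : g ∉ H) : signChar H hH g = -1 := by
  classical
  change (if g ∈ H then (1 : ℤˣ) else -1) = -1
  rw [if_neg hg]

/-- The kernel of `signChar` is `H`. -/
theorem signChar_eq_one_iff (hH : H.index = 2) (g : G) : signChar H hH g = 1 ↔ g ∈ H := by
  constructor
  · intro h
    by_contra hg
    rw [signChar_apply_of_notMem H hH hg] at h
    exact absurd h (by decide)
  · exact signChar_apply_of_mem H hH

/-- `signChar g = −1` iff `g ∉ H`. -/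
theorem signChar_eq_neg_one_iff (hH : H.index = 2) (g : G) : signChar H hH g = -1 ↔ g ∉ H := by
  constructor
  · intro h hg
    rw [signChar_apply_of_mem H hH hg] at h
    exact absurd h (by decide)
  · exact signChar_apply_of_notMem H hH

/-- `signChar` is quadratic. -/
theorem signChar_sq (hH : H.index = 2) (g : G) : signChar H hH g ^ 2 = 1 := Int.units_sq _

/-- `ker signChar = H` as subgroups. -/
theorem ker_signChar (hH : H.index = 2) : (signChar H hH).ker = H := by
  ext g
  rw [MonoidHom.mem_ker, signChar_eq_one_iff]

/-- An index-2 subgroup is proper: some `g ∉ H`. -/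
theorem exists_notMem (hH : H.index = 2) : ∃ g : G, g ∉ H := by
  by_contra h
  simp only [not_exists, not_not] at h
  have : H = ⊤ := Subgroup.eq_top_iff' H |>.mpr h
  rw [← Subgroup.index_eq_one, hH] at this
  exact absurd this (by norm_num)

/-- `signChar` is non-trivial. -/
theorem signChar_ne_one (hH : H.index = 2) : signChar H hH ≠ 1 := by
  obtain ⟨g, hg⟩ := exists_notMem H hH
  intro h
  have := signChar_apply_of_notMem H hH hg
  rw [h, MonoidHom.one_apply] at this
  exact absurd this (by decide)

/-- UNIQUENESS: a character `G →* ℤˣ` with kernel `H` is `signChar`. -/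
theorem eq_signChar (hH : H.index = 2) (χ : G →* ℤˣ) (hχ : ∀ g, χ g = 1 ↔ g ∈ H) : χ = signChar H hH := by
  refine MonoidHom.ext fun g => ?_
  by_cases hg : g ∈ H
  · rw [(hχ g).mpr hg, signChar_apply_of_mem H hH hg]
  · rw [signChar_apply_of_notMem H hH hg]
    rcases Int.units_eq_one_or (χ g) with h | h
    · exact absurd ((hχ g).mp h) hg
    · exact h

/-- Any character of `G` trivial on `H` is a power of `signChar` (`1` or `signChar`): a character
`χ : G →* M` with `χ` trivial on `H` factors through `G ⧸ H ≅ ℤ/2`; in particular it is determined by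
its value at one `g ∉ H`, which squares to `1`. -/
theorem apply_eq_of_eq_one_on (hH : H.index = 2) [DecidablePred (· ∈ H)] {M : Type*} [CommGroup M]
    (χ : G →* M) (hχ : ∀ h ∈ H, χ h = 1) {g₀ : G} (hg₀ : g₀ ∉ H) (g : G) :
    χ g = if g ∈ H then 1 else χ g₀ := by
  by_cases hg : g ∈ H
  · rw [if_pos hg]; exact hχ g hg
  · rw [if_neg hg]
    have : g * g₀⁻¹ ∈ H := by
      rw [Subgroup.mul_mem_iff_of_index_two hH, Subgroup.inv_mem_iff]
      exact ⟨fun h => absurd h hg, fun h => absurd h hg₀⟩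
    have h1 := hχ _ this
    rw [map_mul, map_inv, mul_inv_eq_one] at h1
    exact h1

/-- The square of the value at a non-member is `1`. -/
theorem sq_apply_eq_one_of_eq_one_on (hH : H.index = 2) {M : Type*} [CommGroup M] (χ : G →* M) (hχ : ∀ h ∈ H, χ h = 1)
    (g₀ : G) : χ g₀ ^ 2 = 1 := by
  rw [← map_pow]
  apply hχ
  rw [sq]
  exact Subgroup.mul_self_mem_of_index_two hH g₀

end Summit.Ventures.HodgeRepro2.T5IndexTwoCharacter
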